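/-
Copyright: lit-balaban cell, Phase-2 proof seat p11 (gen 5).  Statement-level skeleton of a published paper; no proof claims beyond
what the kernel checks below.
-/
import Literature.MathematicalPhysics.QuantumFieldTheory.BalabanImbrieJaffe1984to88.BIJ85AbelianStokes

/-!
# `BalabanImbrieJaffe1984to88.BIJ85HolonomyDefect` — T. Bałaban, J. Imbrie, A. Jaffe, *Renormalization of the Higgs model:
minimizers, propagators and the stability of mean field theory*, Commun. Math. Phys. **97** (1985) 299–329
[BalabanImbrieJaffe1985]: Sect. 7.3 p. 326 at a GENERAL background — **the holonomy defects of the covariant block averages are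
controlled by the plaquette variables**.  For a `U(1)` field `u` on the `η`-lattice torus with `‖u(∂p) − 1‖ ≤ θ` on every plaquette:
(a) the holonomy around the ribbon swept by the standard contour `Γ_{yx}` (2.4)–(2.5) translated by a multiple of `L` in a lattice
direction deviates from `1` by at most `d(L−1)·(rung length)·θ`; (b) the TREE LOOP `Γ_{yx} ∘ ⟨x, x+e_ν⟩ ∘ Γ_{y,x+e_ν}^{−1}` of an in-block
bond deviates by at most `d(L−1)θ`; (c) the BLOCK-CONTOUR holonomy `ρ_μ(x)` of gen 4's covariant block-averaging inequality
(`BIJ85BlockAveragingIneqCov.sum_norm_qCovK_shift_sub_sq_le_cov`, the loop of (2.10) at level `k` through the composite contours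
(5.1.2)–(5.1.3)), with the coarse transport `W = u^{(k)} = lineIter u k`, deviates by at most `d·L^k(L^k − 1)·θ`.  File 2 of the
general-background member of SKELETON row **C1.Eq7.3.1-7.3.2** (seat p11 gen 5; file 1 `BIJ85AbelianStokes`).

RELATION TO p33 g6's `BIJ85HolonomyDeviation` / `BIJ85Ineq732Background.norm_defect_bg454_sub_one_le` (same row, landed meanwhile):
there the defects are bounded from BONDWISE deviations `|u_b − 1| ≤ T` (resp. the (4.5.4) shape); here from the PLAQUETTE variables only
(abelian Stokes, file 1), for an arbitrary `U(1)` field.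

statement-level skeleton of published theorems with citation tags; proofs where landed; nothing here is a claim about the Yang–Mills mass gap

PDF held: `paper:balaban1985-cmp97-bij-higgs-minimizers` (journal page = PDF page + 298).  Pages read this session: p. 325–326 [PDF 27–28].

CITATION HEADER (lean-in-tree rule).  Phase-2 file of the lit-balaban TYPED SKELETON (HOME `run/shared/lean/pub/lit-balaban/`), seat
p11 gen 5 (unit `lit-balaban-p11-g5`; TAKING line HOME/STATUS.md 2026-08-21T10:52:36Z; owner r15, referee ref-5).  WHAT IS REPRODUCED:
HOME/GAPS.md **G-C1-05 item (i)** for SKELETON row **C1.Eq7.3.1-7.3.2** (`typed p239582`; *"NO printed proof — 'extension of the proofs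
of [7]'"*): *"the covariant block-averaging inequality picks up, for each x ∈ B^k(y), the holonomy of u around the closed contour
Γ^{(k)}_{yx} ∘ ⟨x, x+L^ke_μ⟩ ∘ (Γ^{(k)}_{y′x′})^{−1} ∘ ⟨y′,y⟩ (a product of O(L^{2k}) η-plaquette variables of u_k), whose deviation from 1
must be controlled by (7.3.1)"* — DONE HERE for every `U(1)` field in terms of its plaquette variables (the passage from the printed
hypothesis on `v` to the `η`-plaquettes of the background `u_k` of (4.5.4) is the regularity input of Sect. 7.2 and is NOT claimed).
Carriers of record only, BY NAME: `Setup` tori/bonds/fields, r18's `BIJ85BlockAveragesTorus` (`corner`, `legSite`/`legBond`/`legProd`,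
`junction`, `holC` = `u(Γ_{yx})`, `runSite`, `IsCross`), `BIJ88RenormTransf311.inBlock`, gen 3's `BIJ85BlockAveragesTorusK` (`runProd`,
`lineU`/`lineIter`, `blkIter`, `holCK` = `u(Γ^{(k)}_{x_k x})`), gen 4's `blkIter_runSite`, file 1's `plaqC`/`legRibbon`.

THE PRINTED TEXT, verbatim (p. 326 [PDF 28]): *"let us assume that for the unit lattice field v, |v(∂p) − 1| ≤ e_k𝓅(e_k), (7.3.1) …
⟨φ, Δ_k(u_k)φ⟩ ≥ γ Σ_{b∈T₁^{(k)}} |u_k(b)φ(b₊) − φ(b₋)|² − Me_k^{2−α} Σ_{x∈T₁^{(k)}} |φ(x)|². (7.3.2) The second form of the inequality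
substitutes v_b for u_k(b) in the covariant derivative of φ. These inequalities can be proved by an extension of the proofs of [7]."*
p. 302 [PDF 4]: *"let Γ_{yx} denote the contour from y to a point x ∈ B(y) given by following the coordinate axis one, then axis two, then
axis three, etc. … define u(Γ) = Π_{b∈Γ} u_b. (2.5)"*; p. 313 [PDF 15]: *"The contour Γ_{x_k,x} runs from x to x₁ in B(x₁), from x₁ to x₂
in B(x₂), etc."* ((5.1.3)).

WHAT IS PROVED (0 `sorry`, standard axioms).  Two definitions with bodies (loop holonomies, as complex numbers): `stairRibbon u μ n x c` =
the holonomy around the ribbon swept by the first `c` legs of `Γ_{yx}` (from the junction site `junction x c` to `x`) translated by `ne_μ`,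
and `bcDefect u k μ s x` = the level-`k` block-contour holonomy with a rung of `s` coarse bonds (at `s = 1`: the `ρ_μ(x)` of gen 4).
* §1–§2 `stairRibbon_succ` (one more leg = one more leg ribbon of file 1), `‖stairRibbon − 1‖ ≤ (Σ_{ν<c} n_ν)·n·θ`
  (`norm_stairRibbon_sub_one_le`; `n_ν = inBlock x ν` the leg lengths).
* §3 translation by a multiple of `L` carries `Γ_{yx}` to `Γ_{y′x′}` (`legSite_runSite_mul`, `holC_runSite_mul`), whence the **block ribbon**
  `‖u(Γ_{yx})^{−1}·R^μ_{Ls}(y)·u(Γ_{y′x′})·R^μ_{Ls}(x)^{−1} − 1‖ ≤ d(L−1)·Ls·θ` (`norm_blockRibbon_sub_one_le`).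
* §4 the **tree loop** of an in-block bond `b = ⟨w, w+e_ν⟩` (`inBlock w ν + 1 < L`): `u(Γ_{y,w+e_ν})^{−1}u(Γ_{yw})u_b = (stairRibbon u ν 1 w ν)^{−1}`
  (`treeLoop_eq`: the legs of `Γ` above `ν` agree, the `ν`-leg gains the bond at the junction, the legs below `ν` are translated by `e_ν`),
  so **`‖u(Γ_{y,w+e_ν})^{−1}u(Γ_{yw})u_b − 1‖ ≤ d(L−1)θ`** (`norm_treeLoop_sub_one_le`).
* §5 the **level-`k` block-contour defect**: `bcDefect (k+1) s = bcDefect k (Ls) · (block ribbon at level k for u^{(k)} with rung Ls)`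
  (`bcDefect_succ`; `u^{(k+1)}`-runs are `u^{(k)}`-runs of `L`-fold length from the corner, file 1 `toC_runProd_lineU`; `(x + L^{k+1}se_μ)_k =
  x_k + Lse_μ`, gen 4 `blkIter_runSite`), whence with file 1's `‖plaqC (lineIter u k) − 1‖ ≤ L^{2k}θ`:
  **`‖bcDefect u k μ s x − 1‖ ≤ d·s·L^k(L^k − 1)·θ`** (`norm_bcDefect_sub_one_le`) and, at `s = 1`, **the defect term of gen 4's covariant
  block-averaging inequality with `W = lineIter u k`: `‖ρ_μ(x) − 1‖ ≤ d·L^k(L^k − 1)·θ ≤ d·(L^{2k}θ)`** for every `x`, `μ`, every torus and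
  every `k` with `j + k ≤ m + K` (`norm_blockContourDefect_sub_one_le`).
HONEST SCOPE.  Everything is for an ARBITRARY `U(1)` field on the `η`-lattice in terms of `θ = max_p ‖u(∂p) − 1‖`; nothing is said about
which `θ` the background `u_k` of (4.5.4) has under (7.3.1) (that is the Sect. 7.2 regularity input, HOME/GAPS.md G-C1-05).
-/

open scoped BigOperators
open Finset

namespace Literature.MathematicalPhysics.QuantumFieldTheory.BalabanImbrieJaffe1984to88.BIJ85HolonomyDefect

open Literature.MathematicalPhysics.QuantumFieldTheory.Balaban1983to89
open BIJ88Sect3Statements (U1 toC toC_one toC_mul norm_toC)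
open BIJ88RenormTransf311 (inBlock)
open BIJ85HolonomyDeviation (norm_inv_sub_one)
open BIJ85BlockAveragesTorus BIJ85BlockAveragesTorusK BIJ85BlockAveragingIneq BIJ85AbelianStokes

noncomputable section

variable {P : Params} {j : ℕ}

/-! ## §1 The legs of `Γ_{yx}` are straight runs; the ribbon swept by the first `c` legs -/

/-- kernel: the leg of `Γ_{yx}` in direction `ν` is the straight run from its first site, `legSite x ν t = legSite x ν 0 + te_ν`.
[cite: BalabanImbrieJaffe1985, (2.4) p.302] -/
theorem legSite_eq_runSite (x : Balaban1983to89.Site P j) (ν : Fin P.d) (t : ℕ) :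
    legSite x ν t = runSite (legSite x ν 0) ν t := by
  funext κ
  by_cases hκ : κ = ν
  · subst hκ
    simp only [runSite, Function.update_self, legSite, lt_irrefl, if_false, if_true, Nat.cast_zero, add_zero]
  · simp only [runSite, Function.update_of_ne hκ, legSite, if_neg hκ]

/-- kernel: `‖u(Γ-leg)‖ = 1`. [cite: BalabanImbrieJaffe1985, (2.5) p.302] -/
theorem norm_legProd (U : GaugeField P j U1) (x : Balaban1983to89.Site P j) (ν : Fin P.d) : ‖legProd U x ν‖ = 1 := by
  simp only [legProd, norm_prod, norm_toC, prod_const_one]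

/-- The holonomy around the RIBBON swept by the first `c` legs of the standard contour `Γ_{yx}` (2.4) — the part of `Γ_{yx}` from the
junction site `junction x c` down to `x` (legs in the directions `ν < c`) — translated by `ne_μ`:
`(Π_{ν<c} u(leg_ν))^{−1} · R^μ_n(junction x c) · (Π_{ν<c} translated legs) · R^μ_n(x)^{−1}` (for `c = d` the whole contour from the corner
`y`; `R^μ_n` the run transport (2.5)). [cite: BalabanImbrieJaffe1985, (2.5) p.302] -/
def stairRibbon (U : GaugeField P j U1) (μ : Fin P.d) (n : ℕ) (x : Balaban1983to89.Site P j) (c : ℕ) : ℂ :=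
  (∏ ν ∈ univ.filter (fun ν : Fin P.d => (ν : ℕ) < c), legProd U x ν)⁻¹ * toC (runProd U (junction x c) μ n)
    * (∏ ν ∈ univ.filter (fun ν : Fin P.d => (ν : ℕ) < c), ∏ t ∈ range (inBlock x ν), toC (U ⟨runSite (legSite x ν t) μ n, ν⟩))
    * (toC (runProd U x μ n))⁻¹

/-- kernel: no legs, no ribbon: `stairRibbon … 0 = 1` (`junction x 0 = x`). [cite: BalabanImbrieJaffe1985, (2.5) p.302] -/
theorem stairRibbon_zero (U : GaugeField P j U1) (μ : Fin P.d) (n : ℕ) (x : Balaban1983to89.Site P j) :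
    stairRibbon U μ n x 0 = 1 := by
  have h0 : univ.filter (fun ν : Fin P.d => (ν : ℕ) < 0) = ∅ := by ext ν; simp
  simp only [stairRibbon, h0, prod_empty, inv_one, one_mul, mul_one, junction_zero]
  exact mul_inv_cancel₀ (toC_ne_zero _)

/-- kernel: `‖stairRibbon‖ = 1`. [cite: BalabanImbrieJaffe1985, (2.5) p.302] -/
theorem norm_stairRibbon (U : GaugeField P j U1) (μ : Fin P.d) (n : ℕ) (x : Balaban1983to89.Site P j) (c : ℕ) :
    ‖stairRibbon U μ n x c‖ = 1 := by
  simp only [stairRibbon, legProd, norm_mul, norm_inv, norm_prod, norm_toC, prod_const_one, inv_one, mul_one]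

/-- kernel: the directions below `c + 1` are `c` and the directions below `c`. [cite: BalabanImbrieJaffe1985, (2.4) p.302] -/
theorem filter_lt_succ {c : ℕ} (hc : c < P.d) :
    univ.filter (fun ν : Fin P.d => (ν : ℕ) < c + 1) = insert ⟨c, hc⟩ (univ.filter (fun ν : Fin P.d => (ν : ℕ) < c)) := by
  ext ν
  simp only [mem_filter, mem_univ, true_and, mem_insert, Fin.ext_iff]
  omega

/-- **Abelian Stokes for `Γ_{yx}`, leg by leg**: adding the leg in direction `c` (from `junction x (c+1)` to `junction x c`, `n_c = inBlock x c`
bonds) multiplies the ribbon holonomy by the leg ribbon of file 1 (standing range: the leg ends at the junction, r18's `legSite_inBlock`).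
[cite: BalabanImbrieJaffe1985, (2.5) p.302] -/
theorem stairRibbon_succ (hj : j + 1 ≤ P.m + P.K) (U : GaugeField P j U1) (μ : Fin P.d) (n : ℕ) (x : Balaban1983to89.Site P j)
    {c : ℕ} (hc : c < P.d) :
    stairRibbon U μ n x (c + 1)
      = stairRibbon U μ n x c * legRibbon U μ n (junction x (c + 1)) ⟨c, hc⟩ (inBlock x ⟨c, hc⟩) := by
  set ν₀ : Fin P.d := ⟨c, hc⟩ with hν₀
  have hw : legSite x ν₀ 0 = junction x (c + 1) := legSite_zero x ν₀
  have hend : runSite (junction x (c + 1)) ν₀ (inBlock x ν₀) = junction x c := by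
    rw [← hw, ← legSite_eq_runSite, legSite_inBlock hj]
  have hleg : legProd U x ν₀ = ∏ s ∈ range (inBlock x ν₀), toC (U ⟨runSite (junction x (c + 1)) ν₀ s, ν₀⟩) := by
    unfold legProd
    refine prod_congr rfl fun s _ => ?_
    show toC (U ⟨legSite x ν₀ s, ν₀⟩) = _
    rw [legSite_eq_runSite, hw]
  have htr : (∏ t ∈ range (inBlock x ν₀), toC (U ⟨runSite (legSite x ν₀ t) μ n, ν₀⟩))
      = ∏ s ∈ range (inBlock x ν₀), toC (U ⟨runSite (runSite (junction x (c + 1)) ν₀ s) μ n, ν₀⟩) :=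
    prod_congr rfl fun s _ => by rw [legSite_eq_runSite, hw]
  have hnot : ν₀ ∉ univ.filter (fun ν : Fin P.d => (ν : ℕ) < c) := by simp [hν₀]
  have hA : (∏ ν ∈ univ.filter (fun ν : Fin P.d => (ν : ℕ) < c), legProd U x ν) ≠ 0 :=
    prod_ne_zero_iff.2 fun _ _ => legProd_ne_zero _ _ _
  have hB : (∏ ν ∈ univ.filter (fun ν : Fin P.d => (ν : ℕ) < c), ∏ t ∈ range (inBlock x ν),
      toC (U ⟨runSite (legSite x ν t) μ n, ν⟩)) ≠ 0 :=
    prod_ne_zero_iff.2 fun _ _ => prod_ne_zero_iff.2 fun _ _ => toC_ne_zero _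
  have hC : (∏ s ∈ range (inBlock x ν₀), toC (U ⟨runSite (junction x (c + 1)) ν₀ s, ν₀⟩)) ≠ 0 :=
    prod_ne_zero_iff.2 fun _ _ => toC_ne_zero _
  have hD : (∏ s ∈ range (inBlock x ν₀), toC (U ⟨runSite (runSite (junction x (c + 1)) ν₀ s) μ n, ν₀⟩)) ≠ 0 :=
    prod_ne_zero_iff.2 fun _ _ => toC_ne_zero _
  have h1 := toC_ne_zero (runProd U (junction x (c + 1)) μ n)
  have h2 := toC_ne_zero (runProd U (junction x c) μ n)
  have h3 := toC_ne_zero (runProd U x μ n)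
  rw [stairRibbon, stairRibbon, legRibbon, filter_lt_succ hc, prod_insert hnot, prod_insert hnot, hleg, htr, hend]
  field_simp

/-- **`‖stairRibbon − 1‖ ≤ (Σ_{ν<c} n_ν)·n·θ`** when every plaquette variable deviates by at most `θ` (`n_ν = inBlock x ν`; file 1's leg
ribbons, added up with `‖ab − 1‖ ≤ ‖a − 1‖ + ‖b − 1‖`; standing range). [cite: BalabanImbrieJaffe1985, (7.3.1) p.326] -/
theorem norm_stairRibbon_sub_one_le (hj : j + 1 ≤ P.m + P.K) (U : GaugeField P j U1) {θ : ℝ}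
    (hθ : ∀ (x : Balaban1983to89.Site P j) (μ ν : Fin P.d), ‖plaqC U x μ ν - 1‖ ≤ θ)
    (μ : Fin P.d) (n : ℕ) (x : Balaban1983to89.Site P j) :
    ∀ c : ℕ, c ≤ P.d → ‖stairRibbon U μ n x c - 1‖
      ≤ (∑ ν ∈ univ.filter (fun ν : Fin P.d => (ν : ℕ) < c), (inBlock x ν : ℝ)) * n * θ
  | 0, _ => by
    have h0 : univ.filter (fun ν : Fin P.d => (ν : ℕ) < 0) = ∅ := by ext ν; simp
    rw [stairRibbon_zero, sub_self, norm_zero, h0, sum_empty, zero_mul, zero_mul]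
  | c + 1, hc => by
    have hc' : c < P.d := hc
    have hnot : (⟨c, hc'⟩ : Fin P.d) ∉ univ.filter (fun ν : Fin P.d => (ν : ℕ) < c) := by simp
    rw [stairRibbon_succ hj U μ n x hc', filter_lt_succ hc', sum_insert hnot, add_mul, add_mul]
    refine (B11V0Interface.norm_mul_sub_one_le _ _ (norm_stairRibbon U μ n x c).le).trans ?_
    rw [add_comm]
    exact add_le_add (norm_legRibbon_sub_one_le U hθ μ n _ _ _) (norm_stairRibbon_sub_one_le hj U hθ μ n x c (by omega))

/-! ## §2 The whole contour: the block ribbon `Γ_{yx}`, `⟨x, x + Lse_μ⟩`, `Γ_{y′x′}^{−1}`, `⟨y′, y⟩` -/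

/-- kernel: all legs at once — at `c = d` the prefix ribbon starts from the corner `y` and the untranslated legs multiply to `u(Γ_{yx})`.
[cite: BalabanImbrieJaffe1985, (2.5) p.302] -/
theorem stairRibbon_d (U : GaugeField P j U1) (μ : Fin P.d) (n : ℕ) (x : Balaban1983to89.Site P j) :
    stairRibbon U μ n x P.d = (holC U x)⁻¹ * toC (runProd U (corner (blockOf x)) μ n)
      * (∏ ν : Fin P.d, ∏ t ∈ range (inBlock x ν), toC (U ⟨runSite (legSite x ν t) μ n, ν⟩)) * (toC (runProd U x μ n))⁻¹ := by
  have hf : univ.filter (fun ν : Fin P.d => (ν : ℕ) < P.d) = univ := by ext ν; simp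
  simp only [stairRibbon, hf, junction_d, holC]

/-- kernel: a translation by `L·s` steps keeps the in-block positions (r18's `inBlock_runSite_L` iterated; standing range).
[cite: BalabanImbrieJaffe1985, (2.10) p.303] -/
theorem inBlock_runSite_mul (hj : j + 1 ≤ P.m + P.K) (x : Balaban1983to89.Site P j) (μ κ : Fin P.d) :
    ∀ s : ℕ, inBlock (runSite x μ (P.L * s)) κ = inBlock x κ
  | 0 => by rw [mul_zero, runSite_zero]
  | s + 1 => by rw [mul_add, mul_one, runSite_add, inBlock_runSite_L hj, inBlock_runSite_mul hj x μ κ s]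

/-- kernel: the corner of the block of the translate is the translate of the corner (gen 4's `blockOf_runSite_mul` + file 1's
`corner_runSite`; standing range). [cite: BalabanImbrieJaffe1985, (2.10) p.303] -/
theorem corner_blockOf_runSite_mul (hj : j + 1 ≤ P.m + P.K) (x : Balaban1983to89.Site P j) (μ : Fin P.d) (s : ℕ) :
    corner (blockOf (runSite x μ (P.L * s))) = runSite (corner (blockOf x)) μ (P.L * s) := by
  rw [blockOf_runSite_mul hj, corner_runSite hj]

/-- kernel: **the standard contours are translation covariant by multiples of `L`**: `Γ_{y′x′}` is `Γ_{yx} + Lse_μ` site by site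
(`x′ = x + Lse_μ`, `y′ = y + se_μ`; standing range). [cite: BalabanImbrieJaffe1985, (2.4) p.302] -/
theorem legSite_runSite_mul (hj : j + 1 ≤ P.m + P.K) (x : Balaban1983to89.Site P j) (μ ν : Fin P.d) (s t : ℕ) :
    legSite (runSite x μ (P.L * s)) ν t = runSite (legSite x ν t) μ (P.L * s) := by
  funext κ
  unfold legSite
  rw [corner_blockOf_runSite_mul hj]
  by_cases hκμ : κ = μ
  · subst hκμ
    simp only [runSite, Function.update_self]
    split_ifs with h1 h2
    · push_cast; ring
    · subst h2; simp only [Function.update_self]; push_cast; ring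
    · push_cast; ring
  · simp only [runSite, Function.update_of_ne hκμ]
    split_ifs with h1 h2
    · rfl
    · subst h2; rw [Function.update_of_ne hκμ]
    · rfl

/-- kernel: hence `u(Γ_{y′x′})` is the product of the translated leg variables (standing range). [cite: BalabanImbrieJaffe1985, (2.5) p.302] -/
theorem holC_runSite_mul (hj : j + 1 ≤ P.m + P.K) (U : GaugeField P j U1) (x : Balaban1983to89.Site P j) (μ : Fin P.d) (s : ℕ) :
    holC U (runSite x μ (P.L * s))
      = ∏ ν : Fin P.d, ∏ t ∈ range (inBlock x ν), toC (U ⟨runSite (legSite x ν t) μ (P.L * s), ν⟩) := by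
  unfold holC legProd
  refine prod_congr rfl fun ν _ => ?_
  rw [inBlock_runSite_mul hj]
  refine prod_congr rfl fun t _ => ?_
  show toC (U ⟨legSite (runSite x μ (P.L * s)) ν t, ν⟩) = _
  rw [legSite_runSite_mul hj]

/-- kernel: the leg lengths add up to at most `d(L−1)`: `Σ_{ν<c} n_ν ≤ d(L−1)`. [cite: BalabanImbrieJaffe1985, (2.4) p.302] -/
theorem sum_inBlock_le (x : Balaban1983to89.Site P j) (c : ℕ) :
    (∑ ν ∈ univ.filter (fun ν : Fin P.d => (ν : ℕ) < c), (inBlock x ν : ℝ)) ≤ P.d * ((P.L : ℝ) - 1) := by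
  have hle : ∀ ν : Fin P.d, (inBlock x ν : ℝ) ≤ (P.L : ℝ) - 1 := fun ν => by
    have h : inBlock x ν < P.L := Nat.mod_lt _ P.L_pos
    have h' : (inBlock x ν : ℝ) + 1 ≤ P.L := by exact_mod_cast h
    linarith
  calc (∑ ν ∈ univ.filter (fun ν : Fin P.d => (ν : ℕ) < c), (inBlock x ν : ℝ))
      ≤ ∑ ν : Fin P.d, (inBlock x ν : ℝ) :=
        sum_le_sum_of_subset_of_nonneg (filter_subset _ _) fun _ _ _ => Nat.cast_nonneg _
    _ ≤ ∑ _ν : Fin P.d, ((P.L : ℝ) - 1) := sum_le_sum fun ν _ => hle ν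
    _ = P.d * ((P.L : ℝ) - 1) := by rw [sum_const, card_univ, Fintype.card_fin, nsmul_eq_mul]

/-- **The block ribbon**: for every `x`, direction `μ` and `s`, with `y` the corner of the block of `x`, `x′ = x + Lse_μ`, `y′ = y + Lse_μ`,
`‖u(Γ_{yx})^{−1}·u(⟨y, y′⟩)·u(Γ_{y′x′})·u(⟨x, x′⟩)^{−1} − 1‖ ≤ d(L−1)·(Ls)·θ` — the holonomy of the closed contour `Γ_{yx} ∘ ⟨x,x′⟩ ∘
Γ_{y′x′}^{−1} ∘ ⟨y′,y⟩` of (2.10) (with a rung of `s` blocks) is within `d(L−1)Lsθ` of `1` (standing range).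
[cite: BalabanImbrieJaffe1985, (2.10) p.303] -/
theorem norm_blockRibbon_sub_one_le (hj : j + 1 ≤ P.m + P.K) (U : GaugeField P j U1) {θ : ℝ}
    (hθ : ∀ (x : Balaban1983to89.Site P j) (μ ν : Fin P.d), ‖plaqC U x μ ν - 1‖ ≤ θ)
    (x : Balaban1983to89.Site P j) (μ : Fin P.d) (s : ℕ) :
    ‖(holC U x)⁻¹ * toC (runProd U (corner (blockOf x)) μ (P.L * s)) * holC U (runSite x μ (P.L * s))
        * (toC (runProd U x μ (P.L * s)))⁻¹ - 1‖ ≤ P.d * ((P.L : ℝ) - 1) * ((P.L * s : ℕ) : ℝ) * θ := by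
  have hθ0 : 0 ≤ θ := (norm_nonneg _).trans (hθ x μ μ)
  rw [holC_runSite_mul hj, ← stairRibbon_d]
  refine (norm_stairRibbon_sub_one_le hj U hθ μ (P.L * s) x P.d le_rfl).trans ?_
  exact mul_le_mul_of_nonneg_right (mul_le_mul_of_nonneg_right (sum_inBlock_le x P.d) (Nat.cast_nonneg _)) hθ0

/-! ## §3 The tree loop of an in-block bond -/

/-- kernel: `Π_μ f(μ) = (Π_{μ<ν} f) · f(ν) · (Π_{ν<μ} f)` over the directions. [cite: BalabanImbrieJaffe1985, (2.4) p.302] -/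
theorem prod_univ_split (ν : Fin P.d) (f : Fin P.d → ℂ) :
    ∏ μ : Fin P.d, f μ = (∏ μ ∈ univ.filter (fun μ : Fin P.d => (μ : ℕ) < ν), f μ) * f ν
      * ∏ μ ∈ univ.filter (fun μ : Fin P.d => (ν : ℕ) < μ), f μ := by
  have hsplit : (univ : Finset (Fin P.d))
      = (univ.filter (fun μ : Fin P.d => (μ : ℕ) < ν) ∪ {ν}) ∪ univ.filter (fun μ : Fin P.d => (ν : ℕ) < μ) := by
    ext μ
    simp only [mem_univ, mem_union, mem_filter, mem_singleton, true_and, true_iff, Fin.ext_iff]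
    omega
  have hd1 : Disjoint (univ.filter (fun μ : Fin P.d => (μ : ℕ) < ν)) {ν} := by simp
  have hd2 : Disjoint (univ.filter (fun μ : Fin P.d => (μ : ℕ) < ν) ∪ {ν}) (univ.filter (fun μ : Fin P.d => (ν : ℕ) < μ)) := by
    rw [disjoint_left]
    intro μ h1 h2
    simp only [mem_union, mem_filter, mem_univ, true_and, mem_singleton, Fin.ext_iff] at h1 h2
    omega
  conv_lhs => rw [hsplit]
  rw [prod_union hd2, prod_union hd1, prod_singleton]

/-- kernel: the end `w + e_ν` of an in-block bond lies in the block of `w` (r18's `blockOf_tgt_of_not_isCross`; standing range).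
[cite: BalabanImbrieJaffe1985, (2.4) p.302] -/
theorem blockOf_shift_of_inBlock (hj : j + 1 ≤ P.m + P.K) {w : Balaban1983to89.Site P j} {ν : Fin P.d}
    (hb : inBlock w ν + 1 < P.L) : blockOf (w.shift ν) = blockOf w :=
  blockOf_tgt_of_not_isCross hj (b := ⟨w, ν⟩) (fun h => by unfold IsCross at h; exact absurd h (ne_of_lt hb))

/-- kernel: the legs of `Γ_{y,w+e_ν}` in the directions `μ ≥ ν` have the same sites as those of `Γ_{yw}` (same block; the coordinates above the
leg direction are those of the end-point, which differ only at `ν`). [cite: BalabanImbrieJaffe1985, (2.4) p.302] -/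
theorem legSite_shift_of_le (hj : j + 1 ≤ P.m + P.K) {w : Balaban1983to89.Site P j} {ν : Fin P.d} (hb : inBlock w ν + 1 < P.L)
    {μ : Fin P.d} (hμ : ν ≤ μ) (t : ℕ) : legSite (w.shift ν) μ t = legSite w μ t := by
  funext κ
  unfold legSite
  rw [blockOf_shift_of_inBlock hj hb]
  by_cases hκν : κ = ν
  · subst hκν
    rcases hμ.lt_or_eq with hlt | heq
    · rw [if_pos hlt, if_pos hlt]
    · subst heq
      rw [if_neg (lt_irrefl _), if_neg (lt_irrefl _), if_pos rfl, if_pos rfl]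
  · simp only [Balaban1983to89.Site.shift, Function.update_of_ne hκν]

/-- kernel: the legs of `Γ_{y,w+e_ν}` in the directions `μ < ν` are those of `Γ_{yw}` translated by `e_ν`. [cite: BalabanImbrieJaffe1985, (2.4) p.302] -/
theorem legSite_shift_of_lt (hj : j + 1 ≤ P.m + P.K) {w : Balaban1983to89.Site P j} {ν : Fin P.d} (hb : inBlock w ν + 1 < P.L)
    {μ : Fin P.d} (hμ : μ < ν) (t : ℕ) : legSite (w.shift ν) μ t = (legSite w μ t).shift ν := by
  funext κ
  unfold legSite
  rw [blockOf_shift_of_inBlock hj hb]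
  by_cases hκν : κ = ν
  · subst hκν
    have h1 : ¬ κ < μ := not_lt.2 hμ.le
    have h2 : ¬ κ = μ := ne_of_gt hμ
    simp only [Balaban1983to89.Site.shift, Function.update_self, h1, h2, if_false]
  · simp only [Balaban1983to89.Site.shift, Function.update_of_ne hκν]

/-- kernel: in-block positions of `w + e_ν`: one more in direction `ν`, unchanged in the others (standing range).
[cite: BalabanImbrieJaffe1985, (2.4) p.302] -/
theorem inBlock_shift (hj : j + 1 ≤ P.m + P.K) {w : Balaban1983to89.Site P j} {ν : Fin P.d} (hb : inBlock w ν + 1 < P.L)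
    (κ : Fin P.d) : inBlock (w.shift ν) κ = if κ = ν then inBlock w ν + 1 else inBlock w κ := by
  by_cases hκ : κ = ν
  · subst hκ
    rw [if_pos rfl, ← runSite_one, inBlock_runSite_lo hj w κ hb]
  · rw [if_neg hκ]
    unfold inBlock
    rw [Balaban1983to89.Site.shift, Function.update_of_ne hκ]

/-- **The tree loop is a prefix ribbon**: for an in-block bond `b = ⟨w, w+e_ν⟩` (`inBlock w ν + 1 < L`),
`u(Γ_{y,w+e_ν})^{−1}·u(Γ_{yw})·u_b = (stairRibbon u ν 1 w ν)^{−1}` — the legs above `ν` cancel, the `ν`-leg of `Γ_{y,w+e_ν}` is that of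
`Γ_{yw}` plus the bond at the junction, the legs below `ν` are translated by `e_ν` (standing range). [cite: BalabanImbrieJaffe1985, (2.5) p.302] -/
theorem treeLoop_eq (hj : j + 1 ≤ P.m + P.K) (U : GaugeField P j U1) {w : Balaban1983to89.Site P j} {ν : Fin P.d}
    (hb : inBlock w ν + 1 < P.L) :
    (holC U (w.shift ν))⁻¹ * holC U w * toC (U ⟨w, ν⟩) = (stairRibbon U ν 1 w ν)⁻¹ := by
  -- the three groups of legs of Γ_{y,w+e_ν}
  have hhi : ∀ μ ∈ univ.filter (fun μ : Fin P.d => (ν : ℕ) < μ), legProd U (w.shift ν) μ = legProd U w μ := by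
    intro μ hμ
    have hμ' : ν < μ := by simpa using hμ
    unfold legProd
    rw [inBlock_shift hj hb, if_neg (ne_of_gt hμ')]
    refine prod_congr rfl fun t _ => ?_
    show toC (U ⟨legSite (w.shift ν) μ t, μ⟩) = toC (U ⟨legSite w μ t, μ⟩)
    rw [legSite_shift_of_le hj hb hμ'.le]
  have hmid : legProd U (w.shift ν) ν = legProd U w ν * toC (U ⟨junction w ν, ν⟩) := by
    unfold legProd
    rw [inBlock_shift hj hb, if_pos rfl, prod_range_succ]
    congr 1
    · refine prod_congr rfl fun t _ => ?_
      show toC (U ⟨legSite (w.shift ν) ν t, ν⟩) = toC (U ⟨legSite w ν t, ν⟩)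
      rw [legSite_shift_of_le hj hb le_rfl]
    · show toC (U ⟨legSite (w.shift ν) ν (inBlock w ν), ν⟩) = _
      rw [legSite_shift_of_le hj hb le_rfl, legSite_inBlock hj]
  have hlo : ∀ μ ∈ univ.filter (fun μ : Fin P.d => (μ : ℕ) < ν),
      legProd U (w.shift ν) μ = ∏ t ∈ range (inBlock w μ), toC (U ⟨runSite (legSite w μ t) ν 1, μ⟩) := by
    intro μ hμ
    have hμ' : μ < ν := by simpa using hμ
    unfold legProd
    rw [inBlock_shift hj hb, if_neg (ne_of_lt hμ')]
    refine prod_congr rfl fun t _ => ?_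
    show toC (U ⟨legSite (w.shift ν) μ t, μ⟩) = _
    rw [legSite_shift_of_lt hj hb hμ', runSite_one]
  have eT : toC (runProd U (junction w ν) ν 1) = toC (U ⟨junction w ν, ν⟩) := toC_runProd_one U _ ν
  have eb : toC (runProd U w ν 1) = toC (U ⟨w, ν⟩) := toC_runProd_one U w ν
  rw [holC, holC, prod_univ_split ν, prod_univ_split ν (legProd U w), prod_congr rfl hhi, hmid, prod_congr rfl hlo, stairRibbon,
    eT, eb]
  have hLo : (∏ μ ∈ univ.filter (fun μ : Fin P.d => (μ : ℕ) < ν), legProd U w μ) ≠ 0 :=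
    prod_ne_zero_iff.2 fun _ _ => legProd_ne_zero _ _ _
  have hT : (∏ μ ∈ univ.filter (fun μ : Fin P.d => (μ : ℕ) < ν), ∏ t ∈ range (inBlock w μ),
      toC (U ⟨runSite (legSite w μ t) ν 1, μ⟩)) ≠ 0 :=
    prod_ne_zero_iff.2 fun _ _ => prod_ne_zero_iff.2 fun _ _ => toC_ne_zero _
  have hG : (∏ μ ∈ univ.filter (fun μ : Fin P.d => (ν : ℕ) < μ), legProd U w μ) ≠ 0 :=
    prod_ne_zero_iff.2 fun _ _ => legProd_ne_zero _ _ _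
  have h1 := legProd_ne_zero U w ν
  have h2 := toC_ne_zero (U ⟨junction w ν, ν⟩)
  have h3 := toC_ne_zero (U ⟨w, ν⟩)
  field_simp

/-- **The tree loop deviates from `1` by at most `d(L−1)θ`**: for every in-block bond `b = ⟨w, w+e_ν⟩` of the `η`-lattice,
`‖u(Γ_{y,w+e_ν})^{−1}·u(Γ_{yw})·u_b − 1‖ ≤ d(L−1)·θ` — the loop through the block corner `y` spans at most `Σ_{μ<ν} n_μ ≤ d(L−1)` plaquettes
(standing range). [cite: BalabanImbrieJaffe1985, (7.3.1) p.326] -/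
theorem norm_treeLoop_sub_one_le (hj : j + 1 ≤ P.m + P.K) (U : GaugeField P j U1) {θ : ℝ}
    (hθ : ∀ (x : Balaban1983to89.Site P j) (μ ν : Fin P.d), ‖plaqC U x μ ν - 1‖ ≤ θ)
    {w : Balaban1983to89.Site P j} {ν : Fin P.d} (hb : inBlock w ν + 1 < P.L) :
    ‖(holC U (w.shift ν))⁻¹ * holC U w * toC (U ⟨w, ν⟩) - 1‖ ≤ P.d * ((P.L : ℝ) - 1) * θ := by
  have hθ0 : 0 ≤ θ := (norm_nonneg _).trans (hθ w ν ν)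
  rw [treeLoop_eq hj U hb, norm_inv_sub_one (norm_stairRibbon U ν 1 w ν)]
  refine (norm_stairRibbon_sub_one_le hj U hθ ν 1 w ν (le_of_lt ν.isLt)).trans ?_
  rw [Nat.cast_one, mul_one]
  exact mul_le_mul_of_nonneg_right (sum_inBlock_le w ν) hθ0

/-! ## §4 The level-`k` block-contour holonomy (the defect of gen 4's covariant block-averaging inequality) -/

/-- The LEVEL-`k` BLOCK-CONTOUR HOLONOMY with a rung of `s` coarse bonds: `u(Γ^{(k)}_{x_k x})^{−1} · u^{(k)}(⟨x_k, x_k + se_μ⟩) ·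
u(Γ^{(k)}_{x_k′x′}) · u(⟨x, x′⟩)^{−1}`, `x′ = x + L^kse_μ` — the loop of (2.10) at level `k` along the composite contours (5.1.3); at `s = 1`
(and `u^{(k)} = lineIter u k` the transport along the unit-lattice bond) it is the `ρ_μ(x)` of gen 4's `BIJ85BlockAveragingIneqCov`.
[cite: BalabanImbrieJaffe1985, (2.10) p.303] -/
def bcDefect (U : GaugeField P j U1) (k : ℕ) (μ : Fin P.d) (s : ℕ) (x : Balaban1983to89.Site P j) : ℂ :=
  (holCK U k x)⁻¹ * toC (runProd (lineIter U k) (blkIter k x) μ s) * holCK U k (runSite x μ (P.L ^ k * s))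
    * (toC (runProd U x μ (P.L ^ k * s)))⁻¹

/-- kernel: at level `0` the contour is degenerate, `bcDefect u 0 μ s x = 1`. [cite: BalabanImbrieJaffe1985, (2.10) p.303] -/
theorem bcDefect_zero (U : GaugeField P j U1) (μ : Fin P.d) (s : ℕ) (x : Balaban1983to89.Site P j) : bcDefect U 0 μ s x = 1 := by
  simp only [bcDefect, holCK_zero, lineIter_zero, blkIter_zero, pow_zero, one_mul, inv_one, mul_one]
  exact mul_inv_cancel₀ (toC_ne_zero _)

/-- kernel: `‖bcDefect‖ = 1`. [cite: BalabanImbrieJaffe1985, (2.10) p.303] -/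
theorem norm_bcDefect (U : GaugeField P j U1) (k : ℕ) (μ : Fin P.d) (s : ℕ) (x : Balaban1983to89.Site P j) :
    ‖bcDefect U k μ s x‖ = 1 := by
  simp only [bcDefect, norm_mul, norm_inv, norm_toC, norm_holCK, inv_one, mul_one]

/-- **The level recursion**: `bcDefect (k+1) s = bcDefect k (Ls) · (the block ribbon at level k for u^{(k)} with rung Ls)` — the composite
contour of level `k + 1` is that of level `k` followed by the standard contour of `u^{(k)}` in `B(x_{k+1})` ((5.1.3) *"from x_k to x_{k+1} in
B(x_{k+1})"*), the `u^{(k+1)}`-bond is the `L`-fold `u^{(k)}`-run from the corner (file 1 `toC_runProd_lineU`), and `(x + L^{k+1}se_μ)_k = x_k +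
Lse_μ` (gen 4 `blkIter_runSite`); standing range `j + k + 1 ≤ m + K`. [cite: BalabanImbrieJaffe1985, (5.1.2)–(5.1.3) p.313] -/
theorem bcDefect_succ {k : ℕ} (hk : j + k + 1 ≤ P.m + P.K) (U : GaugeField P j U1) (μ : Fin P.d) (s : ℕ)
    (x : Balaban1983to89.Site P j) :
    bcDefect U (k + 1) μ s x
      = bcDefect U k μ (P.L * s) x
        * ((holC (lineIter U k) (blkIter k x))⁻¹ * toC (runProd (lineIter U k) (corner (blockOf (blkIter k x))) μ (P.L * s))
            * holC (lineIter U k) (runSite (blkIter k x) μ (P.L * s))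
            * (toC (runProd (lineIter U k) (blkIter k x) μ (P.L * s)))⁻¹) := by
  have e : P.L ^ (k + 1) * s = P.L ^ k * (P.L * s) := by rw [pow_succ, mul_assoc]
  have hx : blkIter k (runSite x μ (P.L ^ k * (P.L * s))) = runSite (blkIter k x) μ (P.L * s) :=
    blkIter_runSite μ k (by omega) x (P.L * s)
  have hT : toC (runProd (lineIter U (k + 1)) (blkIter (k + 1) x) μ s)
      = toC (runProd (lineIter U k) (corner (blockOf (blkIter k x))) μ (P.L * s)) := by
    rw [lineIter_succ, blkIter_succ, toC_runProd_lineU hk]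
  simp only [bcDefect, e, holCK_succ, hx, hT]
  have h1 := holC_ne_zero (lineIter U k) (blkIter k x)
  have h2 := holCK_ne_zero U k x
  have h3 := toC_ne_zero (runProd (lineIter U k) (corner (blockOf (blkIter k x))) μ (P.L * s))
  have h4 := holC_ne_zero (lineIter U k) (runSite (blkIter k x) μ (P.L * s))
  have h5 := holCK_ne_zero U k (runSite x μ (P.L ^ k * (P.L * s)))
  have h6 := toC_ne_zero (runProd U x μ (P.L ^ k * (P.L * s)))
  have h7 := toC_ne_zero (runProd (lineIter U k) (blkIter k x) μ (P.L * s))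
  field_simp

/-- **`‖bcDefect u k μ s x − 1‖ ≤ d·s·L^k(L^k − 1)·θ`** for every `U(1)` field whose plaquette variables deviate from `1` by at most `θ`, every
`k` with `j + k ≤ m + K`, every rung `s`, site `x`, direction `μ` — by the level recursion, the block ribbon bound at level `k` and file 1's
`‖plaqC (lineIter u k) − 1‖ ≤ L^{2k}θ`: `d(Ls)L^k(L^k−1)θ + d(L−1)(Ls)L^{2k}θ = dsL^{k+1}(L^{k+1}−1)θ`. [cite: BalabanImbrieJaffe1985, (7.3.1) p.326] -/
theorem norm_bcDefect_sub_one_le (U : GaugeField P j U1) {θ : ℝ}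
    (hθ : ∀ (x : Balaban1983to89.Site P j) (μ ν : Fin P.d), ‖plaqC U x μ ν - 1‖ ≤ θ) (μ : Fin P.d) :
    ∀ (k : ℕ), j + k ≤ P.m + P.K → ∀ (s : ℕ) (x : Balaban1983to89.Site P j),
      ‖bcDefect U k μ s x - 1‖ ≤ P.d * s * (P.L : ℝ) ^ k * ((P.L : ℝ) ^ k - 1) * θ
  | 0, _, s, x => by
    rw [bcDefect_zero, sub_self, norm_zero, pow_zero, sub_self, mul_zero, zero_mul]
  | k + 1, hk, s, x => by
    have hk' : j + k + 1 ≤ P.m + P.K := by omega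
    rw [bcDefect_succ hk' U μ s x]
    refine (B11V0Interface.norm_mul_sub_one_le _ _ (norm_bcDefect U k μ (P.L * s) x).le).trans ?_
    have hA := norm_bcDefect_sub_one_le U hθ μ k (by omega) (P.L * s) x
    have hB := norm_blockRibbon_sub_one_le (j := j + k) hk' (lineIter U k)
      (fun y μ' ν' => norm_plaqC_lineIter_sub_one_le U hθ k (by omega) y μ' ν') (blkIter k x) μ s
    have e : (P.d : ℝ) * ((P.L * s : ℕ) : ℝ) * (P.L : ℝ) ^ k * ((P.L : ℝ) ^ k - 1) * θ
        + P.d * ((P.L : ℝ) - 1) * ((P.L * s : ℕ) : ℝ) * (((P.L : ℝ) ^ 2) ^ k * θ)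
        = P.d * s * (P.L : ℝ) ^ (k + 1) * ((P.L : ℝ) ^ (k + 1) - 1) * θ := by
      push_cast
      ring
    rw [← e]
    exact add_le_add hA hB

/-- **THE DEFECT OF GEN 4'S COVARIANT BLOCK-AVERAGING INEQUALITY IS CONTROLLED BY THE PLAQUETTES.**  For every `U(1)` field `u` on the
`η`-lattice torus with `‖u(∂p) − 1‖ ≤ θ` for every plaquette `p` (`θ ≥ 0`), every `k` with `j + k ≤ m + K`, every site `x` and direction `μ`:
with `W = lineIter u k` (the transport of `u` along the unit-lattice bond, `u_k(b)` of the first printed form of (7.3.2)),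
`‖u(Γ^{(k)}_x)^{−1}·W(⟨x_k, x_k+e_μ⟩)·u(Γ^{(k)}_{x+L^ke_μ})·u(run_{x,μ,L^k})^{−1} − 1‖ ≤ d·L^k(L^k − 1)·θ` — exactly the `ρ_μ(x)` of
`BIJ85BlockAveragingIneqCov.sum_norm_qCovK_shift_sub_sq_le_cov`.  (HOME/GAPS.md G-C1-05 item (i), for every `u` in terms of its
plaquettes.) [cite: BalabanImbrieJaffe1985, (7.3.2) p.326] -/
theorem norm_blockContourDefect_sub_one_le' {k : ℕ} (hk : j + k ≤ P.m + P.K) (U : GaugeField P j U1) {θ : ℝ}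
    (hθ : ∀ (x : Balaban1983to89.Site P j) (μ ν : Fin P.d), ‖plaqC U x μ ν - 1‖ ≤ θ)
    (x : Balaban1983to89.Site P j) (μ : Fin P.d) :
    ‖(holCK U k x)⁻¹ * toC (lineIter U k ⟨blkIter k x, μ⟩) * holCK U k (runSite x μ (P.L ^ k))
        * (toC (runProd U x μ (P.L ^ k)))⁻¹ - 1‖ ≤ P.d * (P.L : ℝ) ^ k * ((P.L : ℝ) ^ k - 1) * θ := by
  have h := norm_bcDefect_sub_one_le U hθ μ k hk 1 x
  rw [bcDefect, toC_runProd_one, mul_one, Nat.cast_one, mul_one] at h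
  exact h

/-- The same with the hypothesis on the tree's plaquette variables `plaqHol` (`μ < ν`), `θ ≥ 0`: **for every `U(1)` field `u` on the
`η`-lattice torus with `‖u(∂p) − 1‖ ≤ θ` for every plaquette `p`, the block-contour defect of gen 4's covariant block-averaging inequality
with `W = lineIter u k` obeys `‖ρ_μ(x) − 1‖ ≤ d·L^k(L^k − 1)·θ`** (HOME/GAPS.md G-C1-05 item (i), for every `u` in terms of its plaquettes).
[cite: BalabanImbrieJaffe1985, (7.3.2) p.326] -/
theorem norm_blockContourDefect_sub_one_le {k : ℕ} (hk : j + k ≤ P.m + P.K) (U : GaugeField P j U1) {θ : ℝ} (hθ0 : 0 ≤ θ)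
    (hP : ∀ p : Balaban1983to89.Plaq P j, ‖toC (GaugeField.plaqHol U p) - 1‖ ≤ θ)
    (x : Balaban1983to89.Site P j) (μ : Fin P.d) :
    ‖(holCK U k x)⁻¹ * toC (lineIter U k ⟨blkIter k x, μ⟩) * holCK U k (runSite x μ (P.L ^ k))
        * (toC (runProd U x μ (P.L ^ k)))⁻¹ - 1‖ ≤ P.d * (P.L : ℝ) ^ k * ((P.L : ℝ) ^ k - 1) * θ :=
  norm_blockContourDefect_sub_one_le' hk U (norm_plaqC_sub_one_le_of_plaqHol U hθ0 hP) x μ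

end

end Literature.MathematicalPhysics.QuantumFieldTheory.BalabanImbrieJaffe1984to88.BIJ85HolonomyDefect
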